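import Literature.NumberTheory.Automorphic.HeckeAlgebraStructureConstants         -- ★ `coeff_toVector_doubleCosetOperator_mul`, `card_pairs_eq_card_inv_mul_mem`, `toVector_injective`
import Literature.NumberTheory.Automorphic.ContractingTransversalDistanceRegular   -- ★ `ncard_translates_of_contracting`, `card_contractingTransversal`
import HarnessLib

/-!
# R90 · S6 — WAVE 8 card W8-g (generic half): the THREE-TERM RECURSION of a rank-one Hecke algebra from a CONTRACTING
# transversal — `T_t · T_{tⁿ} = T_{t^{n+1}} + |X₀| · T_{tⁿ} + |X₊| · T_{t^{n-1}}` in `ℋ(G, K)` over any commutative ring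
# (`Theorems/R90S6HeckeThreeTermRecursion.lean`)

Cell `hodgecm-mathlib`, crux H413 (`stmt-HodgeConjecture-24833`), route `HCCMUnconditional`; R90-TF section S6 (base `R90-C14`), seat R90-C14-p09 (g0);
S6 WAVE 8 card W8-g «closed-form rank-one Satake ∕ Macdonald» (dealer R90-C14-plan (g2), R90 bus 2026-09-04T23:40:33Z), DAG r5 row E1.3.2.1 («only the
recursion `T₁·φ_m = φ_{m+1} + a_m φ_m + b_m φ_{m−1}` on the biregular tree remains»).  Lane `--supports stmt-HodgeConjecture-24833 --as helper`; THEOREMS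
ONLY (no definition ∕ instance ∕ notation ∕ named fact ∕ `sorry`); imports = ★ `HeckeAlgebraStructureConstants` + ★ `ContractingTransversalDistanceRegular` +
HarnessLib.  GENERIC: any Hecke pair `(G, K)`, any commutative ring `k`; the `U(3)` instance is the sequel `Theorems/R90S6MacdonaldRankOne.lean`.

THE PRINT.  [Macdonald1971, Ch. V §3] (rank one: the Hecke operators of a group acting on a semi-homogeneous tree satisfy a three-term recurrence with the
tree's parameters); [SerreTrees1980, II.1.1] (radius-one neighbours of a vertex at radius `n`: `ab` at radius `n+1`, `b−1` at radius `n`, `1` at radius `n−1`);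
[BruhatTits1972, (4.4.3)–(4.4.4)] (the same in group form); the structure constants of a Hecke ring [ShimuraIATAF1971, §3.1 (3.1.1), Prop. 3.2],
[AndrianovZhuravlev2015, Ch. 3 §1.1 Lemma 1.5]; [CartierCorvallis1979, §IV (4.2), Thm. 4.1].  In the tree the neighbour pattern is ★
`SphericalCoefficient.ncard_translates_of_contracting` (contracting transversal `X = X₊ ∪ X₀ ∪ {t⁻¹}` of `KtK/K` ⇒ the translates `tⁿx` split `|X₊| ∕ |X₀| ∕ 1`
over the shells `K t^{n+1} K ∕ K tⁿ K ∕ K t^{n−1} K`).  THIS FILE turns that count into the PRODUCT FORMULA of `ℋ_k(G, K) = End_G(k[G ⧸ K])`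
(★ `heckeAlgebra`, `doubleCosetOperator K g = T_g`): §1 transversal bookkeeping in `G ⧸ K` and THE KEY BIJECTION `card_filter_inv_mul_eq_card_filter_mul`
(`#{σ ∈ Y : σ⁻¹h ∈ KtK} = #{x ∈ X : h x ∈ Kg′K}` for transversals `X` of a symmetric `KtK/K`, `Y` of `Kg′K/K`); §2 with Shimura's coset form ★
`card_pairs_eq_card_inv_mul_mem` of ★ `coeff_toVector_doubleCosetOperator_mul`: the coefficient of `[hK]` in `(T_t T_{g′})[K]` is `#{x ∈ X : h x ∈ Kg′K}`;
§3 the structure constants of `T_t T_{tⁿ}` and the quotable forms **`doubleCosetOperator_mul_pow_eq_of_contracting`** (`n ≥ 2`: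
`T_t T_{tⁿ} = T_{t^{n+1}} + |X₀| T_{tⁿ} + |X₊| T_{t^{n−1}}`), **`doubleCosetOperator_mul_self_eq_of_contracting`** (`T_t² = T_{t²} + |X₀| T_t + (|X₊|+|X₀|+1)·1`),
via ★ `toVector_injective`.  Binders TOKEN-COMPATIBLE with ★ `ncard_translates_of_contracting` ∕ ★ `exists_contractingTransversal_unitary_three`, so every
contracting-transversal datum in the tree (today the unramified `U(3)`; `U(2)`, `GL₂`, `PGL₂` the hour their transversals are typed) yields its recursion in one line.
HONEST LABEL: Hecke-algebra bookkeeping; proves no printed global statement, discharges no citation; count-neutral helper until E1.3.2.1 ∕ E1.3.5.2.5 ∕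
E1.4.4.2.3 consume it.  HC_CM is proved only modulo the 7 printed citations (2 remaining named inputs: hLiu418 = stmt-HodgeConjecture-24832, h413 =
stmt-HodgeConjecture-24833) until rung 0 closes; REL ≠ ★ ≠ BUILT.

## Tree search
★ `heckeAlgebra.coeff_toVector_doubleCosetOperator_mul`, `card_pairs_eq_card_inv_mul_mem`, `toVector_doubleCosetOperator`, `coeff_doubleCosetIndicator`,
`toVector_injective`, `doubleCosetOperator_one`, `coe_mem_orbit_coe_iff`, `finite_orbit_quotient`; ★ `ncard_translates_of_contracting`, `card_contractingTransversal`;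
the private bookkeeping lemmas of `HeckeAlgebraStructureConstants` (`card_filter_eq_ncard_sep`, `ncard_sep_smul_eq`, `card_filter_mul_mem_orbit_eq`) are
re-derived in §1.  Dedup: `rg "mul_pow_eq_of_contracting|ThreeTermRecursion|card_filter_inv_mul"` over `lean/` — no hit (★ `RankOneHeckeRecurrenceNotSquareSummable`
is the abstract sequence form only).

## References
* [Macdonald1971] I. G. Macdonald, *Spherical functions on a group of p-adic type*, Ramanujan Inst. Publ. 2 (1971), Ch. V §3.
* [CartierCorvallis1979] P. Cartier, *Representations of 𝔭-adic groups: a survey*, PSPM 33.1 (1979), §IV (4.2), Thm. 4.1.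
* [SerreTrees1980] J.-P. Serre, *Trees* (1980), II.1.1.
* [BruhatTits1972] F. Bruhat, J. Tits, *Groupes réductifs sur un corps local I*, Publ. Math. IHÉS 41 (1972), (4.4.3)–(4.4.4).
* [ShimuraIATAF1971] G. Shimura, *Introduction to the Arithmetic Theory of Automorphic Functions* (1971), §3.1 (3.1.1), Prop. 3.2.
* [AndrianovZhuravlev2015] A. N. Andrianov, V. G. Zhuravlev, *Modular Forms and Hecke Operators*, Ch. 3 §1.1 Lemma 1.5.
-/

set_option autoImplicit false
-- the mandated namespace repeats the single-problem summit's segment (`HodgeConjecture.HodgeConjecture`)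
set_option linter.dupNamespace false

open MulAction MonoidAlgebra
open scoped Pointwise

namespace Summit.HodgeConjecture.HodgeConjecture.R90.S6

open Literature.NumberTheory.Automorphic Literature.NumberTheory.Automorphic.heckeAlgebra
  Literature.NumberTheory.Automorphic.SphericalCoefficient

/-! ## §1 Transversal bookkeeping in `G ⧸ K` (orbit language ↔ double-coset language) -/

section Transversal

variable {G : Type*} [Group G] {K : Subgroup G}

/-- `xK ∈ K·gK ↔ x ∈ KgK` (orbit of the `K`-action on `G ⧸ K` ↔ `DoubleCoset.doubleCoset`). [folklore] -/
theorem coe_mem_orbit_coe_iff_mem_doubleCoset (g x : G) :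
    (x : G ⧸ K) ∈ orbit K (g : G ⧸ K) ↔ x ∈ DoubleCoset.doubleCoset g (K : Set G) K := by
  rw [heckeAlgebra.coe_mem_orbit_coe_iff, DoubleCoset.mem_doubleCoset]
  simp only [SetLike.mem_coe]

/-- `#{y ∈ s : P(yK)} = #{η ∈ KgK/K : P η}` for a transversal `s` of `KgK/K`. [folklore] -/
theorem card_filter_transversal_eq_ncard {g : G} {s : Finset G}
    (hs : Set.BijOn (fun y : G => (y : G ⧸ K)) s (orbit K (g : G ⧸ K))) (P : G ⧸ K → Prop)
    [DecidablePred fun y : G => P (y : G ⧸ K)] :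
    (s.filter fun y : G => P (y : G ⧸ K)).card = {η ∈ orbit K (g : G ⧸ K) | P η}.ncard := by
  have himg : {η ∈ orbit K (g : G ⧸ K) | P η} = (fun y : G => (y : G ⧸ K)) '' ((s.filter fun y : G => P (y : G ⧸ K)) : Set G) := by
    ext η
    constructor
    · rintro ⟨hη, hP⟩
      obtain ⟨y, hy, rfl⟩ := hs.surjOn hη
      exact ⟨y, Finset.mem_coe.2 (Finset.mem_filter.2 ⟨Finset.mem_coe.1 hy, hP⟩), rfl⟩
    · rintro ⟨y, hy, rfl⟩
      obtain ⟨hy, hP⟩ := Finset.mem_filter.1 (Finset.mem_coe.1 hy)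
      exact ⟨hs.mapsTo (Finset.mem_coe.2 hy), hP⟩
  rw [himg, (hs.injOn.mono (Finset.coe_subset.2 (Finset.filter_subset _ _))).ncard_image, Set.ncard_coe_finset]

/-- Translating by `b ∈ K` permutes `KgK/K`: `#{η ∈ KgK/K : P(b • η)} = #{η ∈ KgK/K : P η}`. [folklore] -/
theorem ncard_sep_orbit_smul_eq (g : G) (b : K) (P : G ⧸ K → Prop) :
    {η ∈ orbit K (g : G ⧸ K) | P (b • η)}.ncard = {η ∈ orbit K (g : G ⧸ K) | P η}.ncard := by
  have himg : {η ∈ orbit K (g : G ⧸ K) | P η} = (fun η : G ⧸ K => b • η) '' {η ∈ orbit K (g : G ⧸ K) | P (b • η)} := by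
    ext η
    constructor
    · rintro ⟨hη, hP⟩
      refine ⟨b⁻¹ • η, ⟨mem_orbit_of_mem_orbit b⁻¹ hη, ?_⟩, smul_inv_smul b η⟩
      rwa [smul_inv_smul]
    · rintro ⟨η', ⟨hη', hP⟩, rfl⟩
      exact ⟨mem_orbit_of_mem_orbit b hη', hP⟩
  rw [himg, Set.ncard_image_of_injective _ (MulAction.injective b)]

/-- **`#{y ∈ s : σ y ∈ KhK}` depends only on the double coset of `σ`**: for `σ ∈ Kg'K`,
`#{y ∈ s : σ y ∈ KhK} = #{y ∈ s : g' y ∈ KhK}` (`s` a transversal of `KgK/K`). [folklore] -/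
theorem card_filter_mul_mem_orbit_eq_of_mem_orbit {g g' h σ : G} [DecidablePred fun z : G ⧸ K => z ∈ orbit K (h : G ⧸ K)]
    {s : Finset G} (hs : Set.BijOn (fun y : G => (y : G ⧸ K)) s (orbit K (g : G ⧸ K))) (hσ : (σ : G ⧸ K) ∈ orbit K (g' : G ⧸ K)) :
    (s.filter fun y : G => ((σ * y : G) : G ⧸ K) ∈ orbit K (h : G ⧸ K)).card =
      (s.filter fun y : G => ((g' * y : G) : G ⧸ K) ∈ orbit K (h : G ⧸ K)).card := by
  classical
  obtain ⟨a, ha, b, hb, rfl⟩ := (heckeAlgebra.coe_mem_orbit_coe_iff K g' σ).1 hσ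
  have key : ∀ y : G, (((a * g' * b * y : G) : G ⧸ K) ∈ orbit K (h : G ⧸ K)) ↔ (g' • ((⟨b, hb⟩ : K) • (y : G ⧸ K)) ∈ orbit K (h : G ⧸ K)) := by
    intro y
    have e : ((a * g' * b * y : G) : G ⧸ K) = (⟨a, ha⟩ : K) • (g' • ((⟨b, hb⟩ : K) • (y : G ⧸ K))) := by
      rw [show a * g' * b * y = a * (g' * (b * y)) by simp only [mul_assoc]]
      rfl
    rw [e]
    constructor
    · intro hmem
      simpa using mem_orbit_of_mem_orbit (⟨a, ha⟩ : K)⁻¹ hmem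
    · exact fun hmem => mem_orbit_of_mem_orbit _ hmem
  have e1 : (s.filter fun y : G => ((a * g' * b * y : G) : G ⧸ K) ∈ orbit K (h : G ⧸ K)) =
      s.filter fun y : G => (fun η : G ⧸ K => g' • ((⟨b, hb⟩ : K) • η) ∈ orbit K (h : G ⧸ K)) (y : G ⧸ K) :=
    Finset.filter_congr fun y _ => key y
  have e2 : (s.filter fun y : G => ((g' * y : G) : G ⧸ K) ∈ orbit K (h : G ⧸ K)) =
      s.filter fun y : G => (fun η : G ⧸ K => g' • η ∈ orbit K (h : G ⧸ K)) (y : G ⧸ K) :=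
    Finset.filter_congr fun y _ => Iff.rfl
  rw [e1, e2, card_filter_transversal_eq_ncard hs (fun η : G ⧸ K => g' • ((⟨b, hb⟩ : K) • η) ∈ orbit K (h : G ⧸ K)),
    card_filter_transversal_eq_ncard hs (fun η : G ⧸ K => g' • η ∈ orbit K (h : G ⧸ K)),
    ncard_sep_orbit_smul_eq g ⟨b, hb⟩ (fun η : G ⧸ K => g' • η ∈ orbit K (h : G ⧸ K))]

/-- **A symmetric double coset is closed under inversion**: if `t⁻¹ ∈ KtK` then `x ∈ KtK → x⁻¹ ∈ KtK` (orbit form).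
[cite: BruhatTits1972, (4.4.3)] -/
theorem inv_coe_mem_orbit_of_inv_mem {t x : G} (hinv : t⁻¹ ∈ DoubleCoset.doubleCoset t (K : Set G) K)
    (hx : (x : G ⧸ K) ∈ orbit K (t : G ⧸ K)) : ((x⁻¹ : G) : G ⧸ K) ∈ orbit K (t : G ⧸ K) := by
  rw [heckeAlgebra.coe_mem_orbit_coe_iff] at hx ⊢
  obtain ⟨a, ha, b, hb, rfl⟩ := hx
  obtain ⟨a', ha', b', hb', ht⟩ := DoubleCoset.mem_doubleCoset.1 hinv
  refine ⟨b⁻¹ * a', K.mul_mem (K.inv_mem hb) ha', b' * a⁻¹, K.mul_mem hb' (K.inv_mem ha), ?_⟩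
  rw [mul_inv_rev, mul_inv_rev, ht]
  simp only [mul_assoc]

/-- **THE KEY BIJECTION.**  For a transversal `X` of a symmetric `KtK/K` (`t⁻¹ ∈ KtK`), a transversal `Y` of `Kg'K/K` and any `h`: `#{σ ∈ Y : σ⁻¹ h ∈ KtK}
= #{x ∈ X : h x ∈ Kg'K}` (both count `{η ∈ Kg'K/K : h⁻¹ • η ∈ KtK/K}`). [cite: ShimuraIATAF1971, §3.1 (3.1.1)] [cite: AndrianovZhuravlev2015, Ch. 3 §1.1 Lemma 1.5] -/
theorem card_filter_inv_mul_eq_card_filter_mul {t g' h : G} {X Y : Finset G}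
    [DecidablePred fun z : G ⧸ K => z ∈ orbit K (t : G ⧸ K)] [DecidablePred fun z : G ⧸ K => z ∈ orbit K (g' : G ⧸ K)]
    (hinv : t⁻¹ ∈ DoubleCoset.doubleCoset t (K : Set G) K)
    (hX : Set.BijOn (fun y : G => (y : G ⧸ K)) X (orbit K (t : G ⧸ K)))
    (hY : Set.BijOn (fun y : G => (y : G ⧸ K)) Y (orbit K (g' : G ⧸ K))) :
    (Y.filter fun σ : G => ((σ⁻¹ * h : G) : G ⧸ K) ∈ orbit K (t : G ⧸ K)).card =
      (X.filter fun x : G => ((h * x : G) : G ⧸ K) ∈ orbit K (g' : G ⧸ K)).card := by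
  classical
  have e1 : (Y.filter fun σ : G => ((σ⁻¹ * h : G) : G ⧸ K) ∈ orbit K (t : G ⧸ K)) =
      Y.filter fun σ : G => (fun η : G ⧸ K => h⁻¹ • η ∈ orbit K (t : G ⧸ K)) (σ : G ⧸ K) := by
    refine Finset.filter_congr fun σ _ => ?_
    change ((σ⁻¹ * h : G) : G ⧸ K) ∈ orbit K (t : G ⧸ K) ↔ ((h⁻¹ * σ : G) : G ⧸ K) ∈ orbit K (t : G ⧸ K)
    exact ⟨fun hm => by simpa only [mul_inv_rev, inv_inv] using inv_coe_mem_orbit_of_inv_mem hinv hm,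
      fun hm => by simpa only [mul_inv_rev, inv_inv] using inv_coe_mem_orbit_of_inv_mem hinv hm⟩
  have e2 : (X.filter fun x : G => ((h * x : G) : G ⧸ K) ∈ orbit K (g' : G ⧸ K)) =
      X.filter fun x : G => (fun ξ : G ⧸ K => h • ξ ∈ orbit K (g' : G ⧸ K)) (x : G ⧸ K) :=
    Finset.filter_congr fun x _ => Iff.rfl
  rw [e1, e2, card_filter_transversal_eq_ncard hY (fun η : G ⧸ K => h⁻¹ • η ∈ orbit K (t : G ⧸ K)),
    card_filter_transversal_eq_ncard hX (fun ξ : G ⧸ K => h • ξ ∈ orbit K (g' : G ⧸ K))]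
  have himg : {η ∈ orbit K (g' : G ⧸ K) | h⁻¹ • η ∈ orbit K (t : G ⧸ K)} =
      (fun ξ : G ⧸ K => h • ξ) '' {ξ ∈ orbit K (t : G ⧸ K) | h • ξ ∈ orbit K (g' : G ⧸ K)} := by
    ext η
    constructor
    · rintro ⟨hη, hη'⟩
      exact ⟨h⁻¹ • η, ⟨hη', by rwa [smul_inv_smul]⟩, smul_inv_smul h η⟩
    · rintro ⟨ξ, ⟨hξ, hξ'⟩, rfl⟩
      exact ⟨hξ', by rwa [inv_smul_smul]⟩
  rw [himg, Set.ncard_image_of_injective _ (MulAction.injective h)]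

/-- Every double coset of a Hecke pair has a finite transversal of its left cosets. [folklore] -/
theorem exists_finset_transversal [IsHeckeTriple (⊤ : Submonoid G) K K] (g : G) :
    ∃ s : Finset G, Set.BijOn (fun y : G => (y : G ⧸ K)) s (orbit K (g : G ⧸ K)) := by
  classical
  obtain ⟨T, hT⟩ := (finite_orbit_quotient K g).exists_finset_coe
  refine ⟨T.image Quotient.out, fun y hy => ?_, fun y hy y' hy' h => ?_, fun η hη => ?_⟩
  · obtain ⟨η, hη, rfl⟩ := Finset.mem_image.1 (Finset.mem_coe.1 hy)
    change ((η.out : G) : G ⧸ K) ∈ orbit K (g : G ⧸ K)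
    rw [QuotientGroup.out_eq', ← hT]
    exact Finset.mem_coe.2 hη
  · obtain ⟨η, -, rfl⟩ := Finset.mem_image.1 (Finset.mem_coe.1 hy)
    obtain ⟨η', -, rfl⟩ := Finset.mem_image.1 (Finset.mem_coe.1 hy')
    simp only [QuotientGroup.out_eq'] at h
    rw [h]
  · rw [← hT, Finset.mem_coe] at hη
    exact ⟨η.out, Finset.mem_coe.2 (Finset.mem_image_of_mem _ hη), QuotientGroup.out_eq' η⟩

end Transversal

/-! ## §2 The structure constants of `T_t · T_{g'}` against a symmetric transversal -/

section Coefficient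

variable {k G : Type*} [CommRing k] [Group G] {K : Subgroup G} [IsHeckeTriple (⊤ : Submonoid G) K K]

/-- **The coefficient of `[hK]` in `(T_t T_{g'}) [K]` is `#{x ∈ X : h x ∈ Kg'K}`** for a transversal `X` of a SYMMETRIC `KtK/K` (`t⁻¹ ∈ KtK`): ★
`coeff_toVector_doubleCosetOperator_mul` + ★ `card_pairs_eq_card_inv_mul_mem` + the key bijection. [cite: ShimuraIATAF1971, §3.1 (3.1.1)] -/
theorem coeff_toVector_mul_eq_card_filter [DecidableEq (G ⧸ K)] {t : G} {X : Finset G}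
    [DecidablePred fun z : G ⧸ K => z ∈ orbit K (t : G ⧸ K)] (g' : G) [DecidablePred fun z : G ⧸ K => z ∈ orbit K (g' : G ⧸ K)]
    (hinv : t⁻¹ ∈ DoubleCoset.doubleCoset t (K : Set G) K)
    (hX : Set.BijOn (fun y : G => (y : G ⧸ K)) X (orbit K (t : G ⧸ K))) (h : G) :
    (toVector K (doubleCosetOperator (k := k) K t * doubleCosetOperator K g')).coeff (h : G ⧸ K) =
      ((X.filter fun x : G => ((h * x : G) : G ⧸ K) ∈ orbit K (g' : G ⧸ K)).card : k) := by
  classical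
  obtain ⟨Y, hY⟩ := exists_finset_transversal (K := K) g'
  rw [coeff_toVector_doubleCosetOperator_mul K t g' hX hY, card_pairs_eq_card_inv_mul_mem K t h Y hX,
    card_filter_inv_mul_eq_card_filter_mul hinv hX hY]

end Coefficient

/-! ## §3 The three-term recursion from a contracting transversal -/

section Recursion

variable {k G : Type*} [CommRing k] [Group G] [DecidableEq G] {K KN : Subgroup G} [IsHeckeTriple (⊤ : Submonoid G) K K] {t : G}
  {Xp X0 : Finset G}

omit [IsHeckeTriple (⊤ : Submonoid G) K K] in
/-- **Where the products land**: for a contracting transversal `X` of `KtK/K`, if `h x ∈ K tⁿ K` for some `x ∈ X` (`n ≥ 1`) then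
`h ∈ K t^{n+1} K ∪ K tⁿ K ∪ K t^{n-1} K` (`h = a tⁿ b x⁻¹`, `b x⁻¹ ∈ x′K`, three-way split of `tⁿ x′`). [cite: SerreTrees1980, II.1.1] [cite: BruhatTits1972, (4.4.4)] -/
theorem mem_orbit_pow_of_mul_mem (hKN : KN ≤ K) (ht : ∀ u ∈ KN, t * u * t⁻¹ ∈ KN)
    (hinv : t⁻¹ ∈ DoubleCoset.doubleCoset t (K : Set G) K)
    (hD : ∀ m n : ℕ, m ≠ n → Disjoint (DoubleCoset.doubleCoset (t ^ m) (K : Set G) K) (DoubleCoset.doubleCoset (t ^ n) (K : Set G) K))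
    (hXp : ∀ x ∈ Xp, x * t⁻¹ ∈ KN) (hX0 : ∀ x ∈ X0, t * x * t⁻¹ ∈ KN)
    (hX : Set.BijOn (fun x : G => (x : G ⧸ K)) (Xp ∪ X0 ∪ {t⁻¹} : Finset G) (orbit K (t : G ⧸ K)))
    {n : ℕ} (hn : 1 ≤ n) {h x : G} (hx : x ∈ Xp ∪ X0 ∪ {t⁻¹}) (hhx : ((h * x : G) : G ⧸ K) ∈ orbit K ((t ^ n : G) : G ⧸ K)) :
    (h : G ⧸ K) ∈ orbit K ((t ^ (n + 1) : G) : G ⧸ K) ∨ (h : G ⧸ K) ∈ orbit K ((t ^ n : G) : G ⧸ K) ∨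
      (h : G ⧸ K) ∈ orbit K ((t ^ (n - 1) : G) : G ⧸ K) := by
  classical
  obtain ⟨a, ha, b, hb, hab⟩ := (heckeAlgebra.coe_mem_orbit_coe_iff K (t ^ n) (h * x)).1 hhx
  have hxinv : ((x⁻¹ : G) : G ⧸ K) ∈ orbit K (t : G ⧸ K) := inv_coe_mem_orbit_of_inv_mem hinv (hX.mapsTo (Finset.mem_coe.2 hx))
  have hbx : ((b * x⁻¹ : G) : G ⧸ K) ∈ orbit K (t : G ⧸ K) := by
    have e : ((b * x⁻¹ : G) : G ⧸ K) = (⟨b, hb⟩ : K) • ((x⁻¹ : G) : G ⧸ K) := rfl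
    rw [e]; exact mem_orbit_of_mem_orbit _ hxinv
  obtain ⟨x', hx', hx'eq⟩ := hX.surjOn hbx
  have hc : x'⁻¹ * (b * x⁻¹) ∈ K := by
    have e : ((x' : G) : G ⧸ K) = ((b * x⁻¹ : G) : G ⧸ K) := hx'eq
    exact QuotientGroup.eq.1 e
  have hh : h = a * (t ^ n * x') * (x'⁻¹ * (b * x⁻¹)) := by
    have e1 : h = a * t ^ n * b * x⁻¹ := by rw [← hab, mul_inv_cancel_right]
    rw [e1]; simp only [mul_assoc, mul_inv_cancel_left]
  obtain ⟨-, -, -, hsplit⟩ := ncard_translates_of_contracting hKN ht hD hXp hX0 hn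
  have hmem : ∀ j : ℕ, t ^ n * x' ∈ DoubleCoset.doubleCoset (t ^ j) (K : Set G) K → (h : G ⧸ K) ∈ orbit K ((t ^ j : G) : G ⧸ K) := by
    intro j hj
    rw [coe_mem_orbit_coe_iff_mem_doubleCoset]
    obtain ⟨a₁, ha₁, b₁, hb₁, e⟩ := DoubleCoset.mem_doubleCoset.1 hj
    refine DoubleCoset.mem_doubleCoset.2 ⟨a * a₁, K.mul_mem ha ha₁, b₁ * (x'⁻¹ * (b * x⁻¹)), K.mul_mem hb₁ hc, ?_⟩
    rw [hh, e]; simp only [mul_assoc]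
  rcases hsplit x' hx' with h1 | h2 | h3
  · exact Or.inl (hmem _ h1)
  · exact Or.inr (Or.inl (hmem _ h2))
  · exact Or.inr (Or.inr (hmem _ h3))

omit [IsHeckeTriple (⊤ : Submonoid G) K K] in
/-- The counts of ★ `ncard_translates_of_contracting` in `Finset.filter`/orbit form: from level `m ≥ 1`, `#{x ∈ X : tᵐ x ∈ K t^j K}` is
`|X₊|`, `|X₀|`, `1` for `j = m+1, m, m-1`. [cite: BruhatTits1972, (4.4.4)] [cite: SerreTrees1980, II.1.1] -/
theorem card_filter_pow_mul_mem_orbit (hKN : KN ≤ K) (ht : ∀ u ∈ KN, t * u * t⁻¹ ∈ KN)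
    (hD : ∀ m n : ℕ, m ≠ n → Disjoint (DoubleCoset.doubleCoset (t ^ m) (K : Set G) K) (DoubleCoset.doubleCoset (t ^ n) (K : Set G) K))
    (hXp : ∀ x ∈ Xp, x * t⁻¹ ∈ KN) (hX0 : ∀ x ∈ X0, t * x * t⁻¹ ∈ KN) {m : ℕ} (hm : 1 ≤ m) (j : ℕ)
    [DecidablePred fun z : G ⧸ K => z ∈ orbit K ((t ^ j : G) : G ⧸ K)] :
    ((Xp ∪ X0 ∪ {t⁻¹}).filter fun x : G => ((t ^ m * x : G) : G ⧸ K) ∈ orbit K ((t ^ j : G) : G ⧸ K)).card =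
      if j = m + 1 then Xp.card else if j = m then X0.card else if j = m - 1 then 1 else 0 := by
  classical
  obtain ⟨hp, h0, hmin, hsplit⟩ := ncard_translates_of_contracting hKN ht hD hXp hX0 hm
  -- the filter in set form
  rw [← Set.ncard_coe_finset, Finset.coe_filter]
  have hset : {x | x ∈ Xp ∪ X0 ∪ {t⁻¹} ∧ ((t ^ m * x : G) : G ⧸ K) ∈ orbit K ((t ^ j : G) : G ⧸ K)} =
      {x | x ∈ Xp ∪ X0 ∪ {t⁻¹} ∧ t ^ m * x ∈ DoubleCoset.doubleCoset (t ^ j) (K : Set G) K} := by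
    ext x
    simp only [Set.mem_setOf_eq, coe_mem_orbit_coe_iff_mem_doubleCoset]
  rw [hset]
  split_ifs with hj1 hj2 hj3
  · subst hj1; exact hp
  · subst hj2; exact h0
  · subst hj3; exact hmin
  -- no translate lands in any other shell
  have hempty : {x | x ∈ Xp ∪ X0 ∪ {t⁻¹} ∧ t ^ m * x ∈ DoubleCoset.doubleCoset (t ^ j) (K : Set G) K} = ∅ := by
    ext x
    simp only [Set.mem_setOf_eq, Set.mem_empty_iff_false, iff_false, not_and]
    intro hx hxj
    rcases hsplit x hx with h1 | h2 | h3
    · exact Set.disjoint_left.1 (hD _ _ (Ne.symm hj1)) h1 hxj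
    · exact Set.disjoint_left.1 (hD _ _ (Ne.symm hj2)) h2 hxj
    · exact Set.disjoint_left.1 (hD _ _ (Ne.symm hj3)) h3 hxj
  rw [hempty, Set.ncard_empty]

/-- **THE STRUCTURE CONSTANTS OF `T_t · T_{tⁿ}`** (`n ≥ 1`): the coefficient of `[hK]` in `(T_t T_{tⁿ}) [K]` is `1`, `|X₀|`, `#{x ∈ X : t^{n-1} x ∈ KtⁿK}`, `0`
according as `h ∈ K t^{n+1} K`, `K tⁿ K`, `K t^{n-1} K`, none. [cite: Macdonald1971, Ch. V §3] [cite: CartierCorvallis1979, §IV Thm. 4.1] [cite: SerreTrees1980, II.1.1] -/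
theorem coeff_toVector_mul_pow [DecidableEq (G ⧸ K)] (hKN : KN ≤ K) (ht : ∀ u ∈ KN, t * u * t⁻¹ ∈ KN)
    (hinv : t⁻¹ ∈ DoubleCoset.doubleCoset t (K : Set G) K)
    (hD : ∀ m n : ℕ, m ≠ n → Disjoint (DoubleCoset.doubleCoset (t ^ m) (K : Set G) K) (DoubleCoset.doubleCoset (t ^ n) (K : Set G) K))
    (hXp : ∀ x ∈ Xp, x * t⁻¹ ∈ KN) (hX0 : ∀ x ∈ X0, t * x * t⁻¹ ∈ KN)
    (hX : Set.BijOn (fun x : G => (x : G ⧸ K)) (Xp ∪ X0 ∪ {t⁻¹} : Finset G) (orbit K (t : G ⧸ K)))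
    {n : ℕ} (hn : 1 ≤ n) (h : G)
    [DecidablePred fun z : G ⧸ K => z ∈ orbit K ((t ^ (n + 1) : G) : G ⧸ K)]
    [DecidablePred fun z : G ⧸ K => z ∈ orbit K ((t ^ n : G) : G ⧸ K)]
    [DecidablePred fun z : G ⧸ K => z ∈ orbit K ((t ^ (n - 1) : G) : G ⧸ K)] :
    (toVector K (doubleCosetOperator (k := k) K t * doubleCosetOperator K (t ^ n))).coeff (h : G ⧸ K) =
      (if (h : G ⧸ K) ∈ orbit K ((t ^ (n + 1) : G) : G ⧸ K) then 1 else 0) +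
        (X0.card : k) * (if (h : G ⧸ K) ∈ orbit K ((t ^ n : G) : G ⧸ K) then 1 else 0) +
        (((Xp ∪ X0 ∪ {t⁻¹}).filter fun x : G => ((t ^ (n - 1) * x : G) : G ⧸ K) ∈ orbit K ((t ^ n : G) : G ⧸ K)).card : k) *
          (if (h : G ⧸ K) ∈ orbit K ((t ^ (n - 1) : G) : G ⧸ K) then 1 else 0) := by
  classical
  rw [coeff_toVector_mul_eq_card_filter (k := k) (t ^ n) hinv hX h]
  -- disjointness of the three shells in orbit form
  have hdis : ∀ i j : ℕ, i ≠ j → (h : G ⧸ K) ∈ orbit K ((t ^ i : G) : G ⧸ K) → (h : G ⧸ K) ∉ orbit K ((t ^ j : G) : G ⧸ K) := by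
    intro i j hij hi hj
    rw [coe_mem_orbit_coe_iff_mem_doubleCoset] at hi hj
    exact Set.disjoint_left.1 (hD i j hij) hi hj
  have h1 : n + 1 ≠ n := Nat.succ_ne_self n
  have h2 : n + 1 ≠ n - 1 := by omega
  have h3 : n ≠ n - 1 := by omega
  by_cases hA : (h : G ⧸ K) ∈ orbit K ((t ^ (n + 1) : G) : G ⧸ K)
  · rw [if_pos hA, if_neg (hdis _ _ h1 hA), if_neg (hdis _ _ h2 hA), mul_zero, mul_zero, add_zero, add_zero,
      card_filter_mul_mem_orbit_eq_of_mem_orbit hX hA,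
      card_filter_pow_mul_mem_orbit hKN ht hD hXp hX0 (by omega : 1 ≤ n + 1) n, if_neg (by omega), if_neg (by omega),
      if_pos (by omega), Nat.cast_one]
  by_cases hB : (h : G ⧸ K) ∈ orbit K ((t ^ n : G) : G ⧸ K)
  · rw [if_neg hA, if_pos hB, if_neg (hdis _ _ h3 hB), mul_one, mul_zero, zero_add, add_zero,
      card_filter_mul_mem_orbit_eq_of_mem_orbit hX hB, card_filter_pow_mul_mem_orbit hKN ht hD hXp hX0 hn n, if_neg (by omega),
      if_pos rfl]
  by_cases hC : (h : G ⧸ K) ∈ orbit K ((t ^ (n - 1) : G) : G ⧸ K)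
  · rw [if_neg hA, if_neg hB, if_pos hC, mul_zero, mul_one, zero_add, zero_add, card_filter_mul_mem_orbit_eq_of_mem_orbit hX hC]
  -- none: no `x` with `h x ∈ K tⁿ K`
  rw [if_neg hA, if_neg hB, if_neg hC, mul_zero, mul_zero, add_zero, add_zero]
  have h0 : ((Xp ∪ X0 ∪ {t⁻¹}).filter fun x : G => ((h * x : G) : G ⧸ K) ∈ orbit K ((t ^ n : G) : G ⧸ K)).card = 0 := by
    rw [Finset.card_eq_zero, Finset.filter_eq_empty_iff]
    intro x hx hhx
    rcases mem_orbit_pow_of_mul_mem hKN ht hinv hD hXp hX0 hX hn hx hhx with h' | h' | h'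
    · exact hA h'
    · exact hB h'
    · exact hC h'
  rw [h0, Nat.cast_zero]

/-- **THE THREE-TERM RECURSION, master form** (`n ≥ 1`): `T_t · T_{tⁿ} = T_{t^{n+1}} + |X₀| · T_{tⁿ} + #{x ∈ X : t^{n-1} x ∈ KtⁿK} · T_{t^{n-1}}` in
`ℋ_k(G, K)`. [cite: Macdonald1971, Ch. V §3] [cite: CartierCorvallis1979, §IV Thm. 4.1] [cite: AndrianovZhuravlev2015, Ch. 3 §1.1 Lemma 1.5] -/
theorem doubleCosetOperator_mul_pow_eq [DecidableEq (G ⧸ K)] (hKN : KN ≤ K) (ht : ∀ u ∈ KN, t * u * t⁻¹ ∈ KN)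
    (hinv : t⁻¹ ∈ DoubleCoset.doubleCoset t (K : Set G) K)
    (hD : ∀ m n : ℕ, m ≠ n → Disjoint (DoubleCoset.doubleCoset (t ^ m) (K : Set G) K) (DoubleCoset.doubleCoset (t ^ n) (K : Set G) K))
    (hXp : ∀ x ∈ Xp, x * t⁻¹ ∈ KN) (hX0 : ∀ x ∈ X0, t * x * t⁻¹ ∈ KN)
    (hX : Set.BijOn (fun x : G => (x : G ⧸ K)) (Xp ∪ X0 ∪ {t⁻¹} : Finset G) (orbit K (t : G ⧸ K)))
    {n : ℕ} (hn : 1 ≤ n) [DecidablePred fun z : G ⧸ K => z ∈ orbit K ((t ^ n : G) : G ⧸ K)] :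
    doubleCosetOperator (k := k) K t * doubleCosetOperator K (t ^ n) =
      doubleCosetOperator K (t ^ (n + 1)) + (X0.card : k) • doubleCosetOperator K (t ^ n) +
        (((Xp ∪ X0 ∪ {t⁻¹}).filter fun x : G => ((t ^ (n - 1) * x : G) : G ⧸ K) ∈ orbit K ((t ^ n : G) : G ⧸ K)).card : k) •
          doubleCosetOperator K (t ^ (n - 1)) := by
  classical
  apply toVector_injective K
  refine MonoidAlgebra.ext (Finsupp.ext fun η => ?_)
  induction η using QuotientGroup.induction_on with
  | H h =>
    rw [map_add, map_add, map_smul, map_smul, MonoidAlgebra.coeff_add, MonoidAlgebra.coeff_add, Finsupp.add_apply,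
      Finsupp.add_apply, MonoidAlgebra.coeff_smul, MonoidAlgebra.coeff_smul, Finsupp.smul_apply, Finsupp.smul_apply, smul_eq_mul,
      smul_eq_mul, toVector_doubleCosetOperator, toVector_doubleCosetOperator, toVector_doubleCosetOperator, coeff_doubleCosetIndicator,
      coeff_doubleCosetIndicator, coeff_doubleCosetIndicator]
    exact coeff_toVector_mul_pow hKN ht hinv hD hXp hX0 hX hn h

/-- **THE THREE-TERM RECURSION OF A RANK-ONE HECKE ALGEBRA** (`n ≥ 2`).  Let `K_N ≤ K ≤ G` (`(G, K)` a Hecke pair), `t ∈ G` with `t K_N t⁻¹ ≤ K_N`,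
`t⁻¹ ∈ KtK`, the shells `K tᵐ K` pairwise disjoint, and `X = X₊ ∪ X₀ ∪ {t⁻¹}` a transversal of `KtK/K` in CONTRACTING position (`x t⁻¹ ∈ K_N` on `X₊`,
`t x t⁻¹ ∈ K_N` on `X₀`).  Then in `ℋ_k(G, K)`: `T_t · T_{tⁿ} = T_{t^{n+1}} + |X₀| · T_{tⁿ} + |X₊| · T_{t^{n-1}}` — Macdonald's rank-one recurrence in the Hecke
algebra itself (`(|X₊|, |X₀|) = (ab, b − 1)` for a semi-homogeneous tree). [cite: Macdonald1971, Ch. V §3] [cite: CartierCorvallis1979, §IV Thm. 4.1]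
[cite: SerreTrees1980, II.1.1] [cite: BruhatTits1972, (4.4.4)] -/
theorem doubleCosetOperator_mul_pow_eq_of_contracting (hKN : KN ≤ K) (ht : ∀ u ∈ KN, t * u * t⁻¹ ∈ KN)
    (hinv : t⁻¹ ∈ DoubleCoset.doubleCoset t (K : Set G) K)
    (hD : ∀ m n : ℕ, m ≠ n → Disjoint (DoubleCoset.doubleCoset (t ^ m) (K : Set G) K) (DoubleCoset.doubleCoset (t ^ n) (K : Set G) K))
    (hXp : ∀ x ∈ Xp, x * t⁻¹ ∈ KN) (hX0 : ∀ x ∈ X0, t * x * t⁻¹ ∈ KN)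
    (hX : Set.BijOn (fun x : G => (x : G ⧸ K)) (Xp ∪ X0 ∪ {t⁻¹} : Finset G) (orbit K (t : G ⧸ K)))
    {n : ℕ} (hn : 2 ≤ n) :
    doubleCosetOperator (k := k) K t * doubleCosetOperator K (t ^ n) =
      doubleCosetOperator K (t ^ (n + 1)) + (X0.card : k) • doubleCosetOperator K (t ^ n) +
        (Xp.card : k) • doubleCosetOperator K (t ^ (n - 1)) := by
  classical
  rw [doubleCosetOperator_mul_pow_eq hKN ht hinv hD hXp hX0 hX (by omega : 1 ≤ n),
    card_filter_pow_mul_mem_orbit hKN ht hD hXp hX0 (by omega : 1 ≤ n - 1) n, if_pos (by omega)]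

/-- **THE SQUARE OF THE BASIC OPERATOR** (`n = 1`): `T_t · T_t = T_{t²} + |X₀| · T_t + (|X₊| + |X₀| + 1) · 1`, the last coefficient being the
degree `#(KtK/K) = #X` (★ `card_contractingTransversal`). [cite: Macdonald1971, Ch. V §3] [cite: CartierCorvallis1979, §IV Thm. 4.1] [cite: SerreTrees1980, II.1.1] -/
theorem doubleCosetOperator_mul_self_eq_of_contracting (hKN : KN ≤ K) (ht : ∀ u ∈ KN, t * u * t⁻¹ ∈ KN)
    (hinv : t⁻¹ ∈ DoubleCoset.doubleCoset t (K : Set G) K)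
    (hD : ∀ m n : ℕ, m ≠ n → Disjoint (DoubleCoset.doubleCoset (t ^ m) (K : Set G) K) (DoubleCoset.doubleCoset (t ^ n) (K : Set G) K))
    (hXp : ∀ x ∈ Xp, x * t⁻¹ ∈ KN) (hX0 : ∀ x ∈ X0, t * x * t⁻¹ ∈ KN)
    (hX : Set.BijOn (fun x : G => (x : G ⧸ K)) (Xp ∪ X0 ∪ {t⁻¹} : Finset G) (orbit K (t : G ⧸ K))) :
    doubleCosetOperator (k := k) K t * doubleCosetOperator K t =
      doubleCosetOperator K (t ^ 2) + (X0.card : k) • doubleCosetOperator K t + ((Xp.card + X0.card + 1 : ℕ) : k) • 1 := by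
  classical
  have h := doubleCosetOperator_mul_pow_eq (k := k) hKN ht hinv hD hXp hX0 hX (le_refl 1)
  -- every `x ∈ X` lies in `KtK`, so the last structure constant is `#X`
  have hall : ∀ x ∈ Xp ∪ X0 ∪ {t⁻¹}, ((t ^ (1 - 1) * x : G) : G ⧸ K) ∈ orbit K ((t ^ 1 : G) : G ⧸ K) := fun x hx => by
    rw [Nat.sub_self, pow_zero, one_mul, pow_one]
    exact hX.mapsTo (Finset.mem_coe.2 hx)
  rw [Finset.filter_true_of_mem hall, card_contractingTransversal hKN ht hD hXp hX0, pow_one, show (1 : ℕ) + 1 = 2 from rfl,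
    Nat.sub_self, pow_zero, doubleCosetOperator_one] at h
  exact h

end Recursion

end Summit.HodgeConjecture.HodgeConjecture.R90.S6
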